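import Literature.NumberTheory.Weil1964.AdelicMetaplecticTensorStripping
import Literature.NumberTheory.Automorphic.FiniteAdeleSchwartzBruhatDirectSum
import Literature.NumberTheory.Automorphic.UnitaryGroupDirectSum
import HarnessLib

/-!
# The finite factor of the adelic metaplectic operators of an orthogonal direct sum `W₁ ⊕ W₂`

Origin: `pub-hodgecm` MODEL-CONSTRUCTION sub-cell, node W2-⊗ (⊗S)-𝔸 (iii)(d2) (finite factor of the
tensor/direct-sum compatibility of the adelic Schrödinger–Weil operators). KERNEL MATHEMATICS ONLY: no
`def … : Prop` records, no `axiom`, no proof hole. A REPRODUCTION of published constructions (Literature side).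

Setting: two index types `ι₁, ι₂`, Gram matrices `T_j ∈ M_{ι_j}(𝔸_F)`, the orthogonal direct sum with Gram matrix
`T = fromBlocks T₁ 0 0 T₂` on `ι₁ ⊕ ι₂`, the global Schrödinger representations `ρ_j = adelicSchrodinger F ι_j T_j`,
`ρ = adelicSchrodinger F (ι₁ ⊕ ι₂) T` [MoeglinVignerasWaldspurger1987, Chap. 2 I.4 Exemple (1)], and the embedding
`Sp(W₁) × Sp(W₂) →* Sp(W₁ ⊕ W₂)`, `(g₁, g₂) ↦ g₁ ⊕ g₂ = UnitaryGroup.spSum T₁ T₂ (g₁, g₂)` [Kudla1984, §1].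

* §1 the Heisenberg embeddings `inlH : H(W₁) →* H(W₁ ⊕ W₂)`, `inrH : H(W₂) →* H(W₁ ⊕ W₂)` (the cross terms of
  `β_{T₁ ⊕ T₂}` vanish), the decomposition `h = inlH h₁ · inrH h₂` of every FINITE Heisenberg element of the sum into
  finite elements of the summands, and the equivariance `(g₁ ⊕ g₂) · inlH h₁ = inlH (g₁ · h₁)` for Weil's section
  `ofSymplectic` [Weil1964, Chap. I n° 5 pp. 150–151];
* §2 the dictionary `ρ(h) = ψ_F(t) · (1 ⊗ (M_{(T y)_f} ∘ T_{x_f}))` for finite `h = ((x, y), t)` (Weil's operators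
  `U(w)` [Weil1964, Chap. I n° 4 p. 149] through the tensor decomposition `𝒮(𝔸_F^ι) = 𝓢((F ⊗ ℝ)^ι) ⊗ 𝒮((𝔸_F^∞)^ι)`),
  the finite slice `φ ⊗ f ↦ φ(a) f` and the injectivity of `B ↦ 1 ⊗ B`, and the block form
  `finOp T (inlH h₁) = finOp T₁ h₁ ⊠ 1` of the finite operators over `ι₁ ⊕ ι₂`;
* §3 **`finSumAut_implements_spSum`**: if `1 ⊗ A_j` implements `g_j` on the finite Heisenberg elements of `W_j`
  (`j = 1, 2`), then `1 ⊗ (A₁ ⊠ A₂)` implements `g₁ ⊕ g₂` on the finite Heisenberg elements of `W₁ ⊕ W₂` — the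
  finite-place content of the functoriality `𝐫_A(s₁ ⊕ s₂) = 𝐫_A(s₁) ⊗ 𝐫_A(s₂)` of Weil's adelic metaplectic
  representation for orthogonal direct sums [Weil1964, Chap. III n° 37–38 pp. 188–190; Kudla1984, §1], in the
  hypothesis shape consumed by `AdelicMetaplecticTensorStripping.exists_continuousLinearEquiv_of_mem_adelicMpCont`;
  and the surjectivity of `y ↦ T y` for the block sum from that of the blocks.

## References
* [Weil1964] A. Weil, *Sur certains groupes d'opérateurs unitaires*, Acta Math. 111 (1964) 143–211, Chap. I n° 4–5
  pp. 149–151, Chap. III n° 37–38 pp. 188–190.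
* [MoeglinVignerasWaldspurger1987] C. Mœglin, M.-F. Vignéras, J.-L. Waldspurger, *Correspondances de Howe sur un
  corps p-adique*, LNM 1291 (1987), Chap. 2 I.4 Exemple (1), II.1 (A).
* [Kudla1984] S. Kudla, *Seesaw dual reductive pairs*, in: Automorphic forms of several variables (Katata 1983),
  Progr. Math. 46 (1984) 244–268, §1.
-/

set_option autoImplicit false

noncomputable section

open scoped Matrix SchwartzMap TensorProduct Classical

open NumberField NumberField.mixedEmbedding IsDedekindDomain

namespace Literature.NumberTheory.Weil1964

open Literature.NumberTheory.Automorphic Literature.RepresentationTheory.HeisenbergGroup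

variable {F : Type} [Field F] [NumberField F]

/-! ### §1 Heisenberg embeddings of the summands -/

section Embeddings

variable {ι₁ ι₂ : Type} [Fintype ι₁] [Fintype ι₂] [DecidableEq ι₁] [DecidableEq ι₂]
variable (T₁ : Matrix ι₁ ι₁ (AdeleRing (𝓞 F) F)) (T₂ : Matrix ι₂ ι₂ (AdeleRing (𝓞 F) F))

/-- `β_{T₁ ⊕ T₂}(x₁ ⊔ x₂, y₁ ⊔ y₂) = β_{T₁}(x₁, y₁) + β_{T₂}(x₂, y₂)`: the summands are orthogonal. [cite: Kudla1984, §1] -/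
theorem adelicForm_fromBlocks_elim (x₁ y₁ : ι₁ → AdeleRing (𝓞 F) F) (x₂ y₂ : ι₂ → AdeleRing (𝓞 F) F) :
    adelicForm F (ι₁ ⊕ ι₂) (Matrix.fromBlocks T₁ 0 0 T₂) (Sum.elim x₁ x₂) (Sum.elim y₁ y₂) =
      adelicForm F ι₁ T₁ x₁ y₁ + adelicForm F ι₂ T₂ x₂ y₂ := by
  rw [show adelicForm F (ι₁ ⊕ ι₂) (Matrix.fromBlocks T₁ 0 0 T₂) (Sum.elim x₁ x₂) (Sum.elim y₁ y₂) = _ from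
    UnitaryGroup.toLinearMap₂'_fromBlocks T₁ T₂ (Sum.elim x₁ x₂) (Sum.elim y₁ y₂), Sum.elim_comp_inl, Sum.elim_comp_inl,
    Sum.elim_comp_inr, Sum.elim_comp_inr]

omit [Fintype ι₁] [Fintype ι₂] [DecidableEq ι₁] [DecidableEq ι₂] in
/-- `c · (a ⊔ b) = (c · a) ⊔ (c · b)`. [folklore] -/
theorem smul_sumElim (c : AdeleRing (𝓞 F) F) (a : ι₁ → AdeleRing (𝓞 F) F) (b : ι₂ → AdeleRing (𝓞 F) F) :
    c • Sum.elim a b = Sum.elim (c • a) (c • b) := by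
  funext i
  cases i <;> rfl

omit [Fintype ι₁] [Fintype ι₂] [DecidableEq ι₁] [DecidableEq ι₂] in
/-- `(a ⊔ 0) + (0 ⊔ b) = a ⊔ b`. [folklore] -/
theorem sumElim_zero_add_zero_sumElim (a : ι₁ → AdeleRing (𝓞 F) F) (b : ι₂ → AdeleRing (𝓞 F) F) :
    Sum.elim a (0 : ι₂ → AdeleRing (𝓞 F) F) + Sum.elim (0 : ι₁ → AdeleRing (𝓞 F) F) b = Sum.elim a b := by
  funext i
  cases i
  · exact add_zero _
  · exact zero_add _

/-- **`H(W₁) →* H(W₁ ⊕ W₂)`**, `((x, y), t) ↦ ((x ⊔ 0, y ⊔ 0), t)` — a group homomorphism because the summands are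
`β_{T₁ ⊕ T₂}`-orthogonal. [cite: Kudla1984, §1] -/
def inlH : AdelicHeisenberg F ι₁ T₁ →* AdelicHeisenberg F (ι₁ ⊕ ι₂) (Matrix.fromBlocks T₁ 0 0 T₂) where
  toFun h := ⟨(Sum.elim h.v.1 0, Sum.elim h.v.2 0), h.t⟩
  map_one' := by
    apply Heisenberg.ext
    · show (Sum.elim (0 : ι₁ → AdeleRing (𝓞 F) F) (0 : ι₂ → AdeleRing (𝓞 F) F),
        Sum.elim (0 : ι₁ → AdeleRing (𝓞 F) F) (0 : ι₂ → AdeleRing (𝓞 F) F)) = 0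
      rw [Sum.elim_zero_zero, Prod.mk_zero_zero]
    · rfl
  map_mul' h h' := by
    apply Heisenberg.ext
    · show (Sum.elim (h.v.1 + h'.v.1) (0 : ι₂ → AdeleRing (𝓞 F) F), Sum.elim (h.v.2 + h'.v.2) (0 : ι₂ → AdeleRing (𝓞 F) F)) =
        (Sum.elim h.v.1 0, Sum.elim h.v.2 0) + (Sum.elim h'.v.1 0, Sum.elim h'.v.2 0)
      rw [Prod.mk_add_mk, ← Sum.elim_add_add, ← Sum.elim_add_add, add_zero]
    · show h.t + h'.t + polar (adelicForm F ι₁ T₁) h.v h'.v =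
        h.t + h'.t + polar (adelicForm F (ι₁ ⊕ ι₂) (Matrix.fromBlocks T₁ 0 0 T₂)) (Sum.elim h.v.1 0, Sum.elim h.v.2 0)
          (Sum.elim h'.v.1 0, Sum.elim h'.v.2 0)
      rw [polar_apply, polar_apply, adelicForm_fromBlocks_elim]
      simp only [map_zero, add_zero]

/-- **`H(W₂) →* H(W₁ ⊕ W₂)`**, `((x, y), t) ↦ ((0 ⊔ x, 0 ⊔ y), t)`. [cite: Kudla1984, §1] -/
def inrH : AdelicHeisenberg F ι₂ T₂ →* AdelicHeisenberg F (ι₁ ⊕ ι₂) (Matrix.fromBlocks T₁ 0 0 T₂) where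
  toFun h := ⟨(Sum.elim (0 : ι₁ → AdeleRing (𝓞 F) F) h.v.1, Sum.elim (0 : ι₁ → AdeleRing (𝓞 F) F) h.v.2), h.t⟩
  map_one' := by
    apply Heisenberg.ext
    · show (Sum.elim (0 : ι₁ → AdeleRing (𝓞 F) F) (0 : ι₂ → AdeleRing (𝓞 F) F),
        Sum.elim (0 : ι₁ → AdeleRing (𝓞 F) F) (0 : ι₂ → AdeleRing (𝓞 F) F)) = 0
      rw [Sum.elim_zero_zero, Prod.mk_zero_zero]
    · rfl
  map_mul' h h' := by
    apply Heisenberg.ext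
    · show (Sum.elim (0 : ι₁ → AdeleRing (𝓞 F) F) (h.v.1 + h'.v.1), Sum.elim (0 : ι₁ → AdeleRing (𝓞 F) F) (h.v.2 + h'.v.2)) =
        (Sum.elim (0 : ι₁ → AdeleRing (𝓞 F) F) h.v.1, Sum.elim (0 : ι₁ → AdeleRing (𝓞 F) F) h.v.2) + (Sum.elim (0 : ι₁ → AdeleRing (𝓞 F) F) h'.v.1, Sum.elim (0 : ι₁ → AdeleRing (𝓞 F) F) h'.v.2)
      rw [Prod.mk_add_mk, ← Sum.elim_add_add, ← Sum.elim_add_add, add_zero]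
    · show h.t + h'.t + polar (adelicForm F ι₂ T₂) h.v h'.v =
        h.t + h'.t + polar (adelicForm F (ι₁ ⊕ ι₂) (Matrix.fromBlocks T₁ 0 0 T₂)) (Sum.elim (0 : ι₁ → AdeleRing (𝓞 F) F) h.v.1, Sum.elim (0 : ι₁ → AdeleRing (𝓞 F) F) h.v.2)
          (Sum.elim (0 : ι₁ → AdeleRing (𝓞 F) F) h'.v.1, Sum.elim (0 : ι₁ → AdeleRing (𝓞 F) F) h'.v.2)
      rw [polar_apply, polar_apply, adelicForm_fromBlocks_elim]
      simp only [map_zero, zero_add]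

variable {T₁ T₂}

/-- vector part of `inlH h`. [folklore] -/
@[simp] theorem inlH_v (h : AdelicHeisenberg F ι₁ T₁) : (inlH T₁ T₂ h).v = (Sum.elim h.v.1 0, Sum.elim h.v.2 0) := rfl

/-- central part of `inlH h`. [folklore] -/
@[simp] theorem inlH_t (h : AdelicHeisenberg F ι₁ T₁) : (inlH T₁ T₂ h).t = h.t := rfl

/-- vector part of `inrH h`. [folklore] -/
@[simp] theorem inrH_v (h : AdelicHeisenberg F ι₂ T₂) : (inrH T₁ T₂ h).v = (Sum.elim (0 : ι₁ → AdeleRing (𝓞 F) F) h.v.1, Sum.elim (0 : ι₁ → AdeleRing (𝓞 F) F) h.v.2) := rfl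

/-- central part of `inrH h`. [folklore] -/
@[simp] theorem inrH_t (h : AdelicHeisenberg F ι₂ T₂) : (inrH T₁ T₂ h).t = h.t := rfl

/-- `inlH` maps finite Heisenberg elements to finite Heisenberg elements. [folklore] -/
theorem inlH_mem_finHeisenberg {h : AdelicHeisenberg F ι₁ T₁} (hh : h ∈ finHeisenberg T₁) :
    inlH T₁ T₂ h ∈ finHeisenberg (Matrix.fromBlocks T₁ 0 0 T₂) := by
  rw [mem_finHeisenberg_iff] at hh ⊢
  rw [inlH_v, Prod.smul_mk, smul_sumElim, smul_sumElim, smul_zero, show finIdem F • h.v.1 = h.v.1 from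
    congrArg Prod.fst hh, show finIdem F • h.v.2 = h.v.2 from congrArg Prod.snd hh]

/-- `inrH` maps finite Heisenberg elements to finite Heisenberg elements. [folklore] -/
theorem inrH_mem_finHeisenberg {h : AdelicHeisenberg F ι₂ T₂} (hh : h ∈ finHeisenberg T₂) :
    inrH T₁ T₂ h ∈ finHeisenberg (Matrix.fromBlocks T₁ 0 0 T₂) := by
  rw [mem_finHeisenberg_iff] at hh ⊢
  rw [inrH_v, Prod.smul_mk, smul_sumElim, smul_sumElim, smul_zero, show finIdem F • h.v.1 = h.v.1 from
    congrArg Prod.fst hh, show finIdem F • h.v.2 = h.v.2 from congrArg Prod.snd hh]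

/-- **Every finite Heisenberg element of `W₁ ⊕ W₂` is a product `inlH h₁ · inrH h₂` of finite Heisenberg elements of
the summands** (`h₁ = ((x|₁, y|₁), t)`, `h₂ = ((x|₂, y|₂), 0)`; the cross term `β(x|₁ ⊔ 0, 0 ⊔ y|₂)` vanishes).
[cite: Kudla1984, §1] -/
theorem exists_eq_inlH_mul_inrH {h : AdelicHeisenberg F (ι₁ ⊕ ι₂) (Matrix.fromBlocks T₁ 0 0 T₂)}
    (hh : h ∈ finHeisenberg (Matrix.fromBlocks T₁ 0 0 T₂)) :
    ∃ h₁ ∈ finHeisenberg T₁, ∃ h₂ ∈ finHeisenberg T₂, h = inlH T₁ T₂ h₁ * inrH T₁ T₂ h₂ := by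
  rw [mem_finHeisenberg_iff] at hh
  have hx : finIdem F • h.v.1 = h.v.1 := congrArg Prod.fst hh
  have hy : finIdem F • h.v.2 = h.v.2 := congrArg Prod.snd hh
  refine ⟨⟨(h.v.1 ∘ Sum.inl, h.v.2 ∘ Sum.inl), h.t⟩, ?_, ⟨(h.v.1 ∘ Sum.inr, h.v.2 ∘ Sum.inr), 0⟩, ?_, ?_⟩
  · rw [mem_finHeisenberg_iff, Prod.smul_mk]
    exact Prod.ext (congrArg (· ∘ Sum.inl) hx) (congrArg (· ∘ Sum.inl) hy)
  · rw [mem_finHeisenberg_iff, Prod.smul_mk]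
    exact Prod.ext (congrArg (· ∘ Sum.inr) hx) (congrArg (· ∘ Sum.inr) hy)
  · apply Heisenberg.ext
    · rw [Heisenberg.mul_v, inlH_v, inrH_v, Prod.mk_add_mk, sumElim_zero_add_zero_sumElim,
        sumElim_zero_add_zero_sumElim, Sum.elim_comp_inl_inr, Sum.elim_comp_inl_inr]
    · show h.t = h.t + 0 + polar (adelicForm F (ι₁ ⊕ ι₂) (Matrix.fromBlocks T₁ 0 0 T₂))
          (Sum.elim (h.v.1 ∘ Sum.inl) (0 : ι₂ → AdeleRing (𝓞 F) F), Sum.elim (h.v.2 ∘ Sum.inl) (0 : ι₂ → AdeleRing (𝓞 F) F))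
          (Sum.elim (0 : ι₁ → AdeleRing (𝓞 F) F) (h.v.1 ∘ Sum.inr), Sum.elim (0 : ι₁ → AdeleRing (𝓞 F) F) (h.v.2 ∘ Sum.inr))
      rw [polar_apply, adelicForm_fromBlocks_elim]
      simp only [map_zero, LinearMap.zero_apply, add_zero]

/-- `(g₁ ⊕ g₂)(x₁ ⊔ x₂, y₁ ⊔ y₂) = ((g₁(x₁,y₁)).1 ⊔ (g₂(x₂,y₂)).1, (g₁(x₁,y₁)).2 ⊔ (g₂(x₂,y₂)).2)`. [cite: Kudla1984, §1] -/
theorem spSum_apply_elim (g₁ : symplecticGroup (polar (adelicForm F ι₁ T₁))) (g₂ : symplecticGroup (polar (adelicForm F ι₂ T₂)))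
    (x₁ y₁ : ι₁ → AdeleRing (𝓞 F) F) (x₂ y₂ : ι₂ → AdeleRing (𝓞 F) F) :
    ((UnitaryGroup.spSum T₁ T₂ (g₁, g₂) : symplecticGroup (polar (adelicForm F (ι₁ ⊕ ι₂) (Matrix.fromBlocks T₁ 0 0 T₂)))) :
        ((ι₁ ⊕ ι₂ → AdeleRing (𝓞 F) F) × (ι₁ ⊕ ι₂ → AdeleRing (𝓞 F) F)) ≃ₗ[AdeleRing (𝓞 F) F]
          ((ι₁ ⊕ ι₂ → AdeleRing (𝓞 F) F) × (ι₁ ⊕ ι₂ → AdeleRing (𝓞 F) F)))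
        (Sum.elim x₁ x₂, Sum.elim y₁ y₂) =
      (Sum.elim ((g₁ : ((ι₁ → AdeleRing (𝓞 F) F) × (ι₁ → AdeleRing (𝓞 F) F)) ≃ₗ[AdeleRing (𝓞 F) F]
          ((ι₁ → AdeleRing (𝓞 F) F) × (ι₁ → AdeleRing (𝓞 F) F))) (x₁, y₁)).1
        ((g₂ : ((ι₂ → AdeleRing (𝓞 F) F) × (ι₂ → AdeleRing (𝓞 F) F)) ≃ₗ[AdeleRing (𝓞 F) F]
          ((ι₂ → AdeleRing (𝓞 F) F) × (ι₂ → AdeleRing (𝓞 F) F))) (x₂, y₂)).1,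
       Sum.elim ((g₁ : ((ι₁ → AdeleRing (𝓞 F) F) × (ι₁ → AdeleRing (𝓞 F) F)) ≃ₗ[AdeleRing (𝓞 F) F]
          ((ι₁ → AdeleRing (𝓞 F) F) × (ι₁ → AdeleRing (𝓞 F) F))) (x₁, y₁)).2
        ((g₂ : ((ι₂ → AdeleRing (𝓞 F) F) × (ι₂ → AdeleRing (𝓞 F) F)) ≃ₗ[AdeleRing (𝓞 F) F]
          ((ι₂ → AdeleRing (𝓞 F) F) × (ι₂ → AdeleRing (𝓞 F) F))) (x₂, y₂)).2) := by
  rw [UnitaryGroup.coe_spSum, UnitaryGroup.spSumEquiv_apply]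
  simp only [Sum.elim_comp_inl, Sum.elim_comp_inr]

/-- **`(g₁ ⊕ g₂) · inlH h₁ = inlH (g₁ · h₁)`** for Weil's section `ofSymplectic` (both the linear part and the
second-degree character `f(w) = ½(β(gw, gw) - β(w, w))` split along the orthogonal sum). [cite: Weil1964, Chap. I n° 5 pp. 150–151] -/
theorem act_spSum_inlH (g₁ : symplecticGroup (polar (adelicForm F ι₁ T₁))) (g₂ : symplecticGroup (polar (adelicForm F ι₂ T₂)))
    (h₁ : AdelicHeisenberg F ι₁ T₁) :
    (ofSymplectic (polar (adelicForm F (ι₁ ⊕ ι₂) (Matrix.fromBlocks T₁ 0 0 T₂))) (UnitaryGroup.spSum T₁ T₂ (g₁, g₂))).act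
        (inlH T₁ T₂ h₁) =
      inlH T₁ T₂ ((ofSymplectic (polar (adelicForm F ι₁ T₁)) g₁).act h₁) := by
  have hv : ((UnitaryGroup.spSum T₁ T₂ (g₁, g₂) : symplecticGroup (polar (adelicForm F (ι₁ ⊕ ι₂) (Matrix.fromBlocks T₁ 0 0 T₂)))) :
        ((ι₁ ⊕ ι₂ → AdeleRing (𝓞 F) F) × (ι₁ ⊕ ι₂ → AdeleRing (𝓞 F) F)) ≃ₗ[AdeleRing (𝓞 F) F]
          ((ι₁ ⊕ ι₂ → AdeleRing (𝓞 F) F) × (ι₁ ⊕ ι₂ → AdeleRing (𝓞 F) F))) (Sum.elim h₁.v.1 0, Sum.elim h₁.v.2 0) =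
      (Sum.elim ((g₁ : ((ι₁ → AdeleRing (𝓞 F) F) × (ι₁ → AdeleRing (𝓞 F) F)) ≃ₗ[AdeleRing (𝓞 F) F]
          ((ι₁ → AdeleRing (𝓞 F) F) × (ι₁ → AdeleRing (𝓞 F) F))) h₁.v).1 0,
        Sum.elim ((g₁ : ((ι₁ → AdeleRing (𝓞 F) F) × (ι₁ → AdeleRing (𝓞 F) F)) ≃ₗ[AdeleRing (𝓞 F) F]
          ((ι₁ → AdeleRing (𝓞 F) F) × (ι₁ → AdeleRing (𝓞 F) F))) h₁.v).2 0) := by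
    rw [spSum_apply_elim, Prod.mk.eta, Prod.mk_zero_zero, map_zero, Prod.fst_zero, Prod.snd_zero]
  apply Heisenberg.ext
  · rw [Heisenberg.PseudoSymplectic.act_v, ofSymplectic_σ, inlH_v, inlH_v, Heisenberg.PseudoSymplectic.act_v, ofSymplectic_σ]
    exact hv
  · simp only [Heisenberg.PseudoSymplectic.act_t, inlH_t, inlH_v, ofSymplectic_f, polar_apply]
    rw [hv, adelicForm_fromBlocks_elim, adelicForm_fromBlocks_elim]
    simp only [map_zero, add_zero]

/-- **`(g₁ ⊕ g₂) · inrH h₂ = inrH (g₂ · h₂)`**. [cite: Weil1964, Chap. I n° 5 pp. 150–151] -/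
theorem act_spSum_inrH (g₁ : symplecticGroup (polar (adelicForm F ι₁ T₁))) (g₂ : symplecticGroup (polar (adelicForm F ι₂ T₂)))
    (h₂ : AdelicHeisenberg F ι₂ T₂) :
    (ofSymplectic (polar (adelicForm F (ι₁ ⊕ ι₂) (Matrix.fromBlocks T₁ 0 0 T₂))) (UnitaryGroup.spSum T₁ T₂ (g₁, g₂))).act
        (inrH T₁ T₂ h₂) =
      inrH T₁ T₂ ((ofSymplectic (polar (adelicForm F ι₂ T₂)) g₂).act h₂) := by
  have hv : ((UnitaryGroup.spSum T₁ T₂ (g₁, g₂) : symplecticGroup (polar (adelicForm F (ι₁ ⊕ ι₂) (Matrix.fromBlocks T₁ 0 0 T₂)))) :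
        ((ι₁ ⊕ ι₂ → AdeleRing (𝓞 F) F) × (ι₁ ⊕ ι₂ → AdeleRing (𝓞 F) F)) ≃ₗ[AdeleRing (𝓞 F) F]
          ((ι₁ ⊕ ι₂ → AdeleRing (𝓞 F) F) × (ι₁ ⊕ ι₂ → AdeleRing (𝓞 F) F))) (Sum.elim (0 : ι₁ → AdeleRing (𝓞 F) F) h₂.v.1, Sum.elim (0 : ι₁ → AdeleRing (𝓞 F) F) h₂.v.2) =
      (Sum.elim (0 : ι₁ → AdeleRing (𝓞 F) F) ((g₂ : ((ι₂ → AdeleRing (𝓞 F) F) × (ι₂ → AdeleRing (𝓞 F) F)) ≃ₗ[AdeleRing (𝓞 F) F]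
          ((ι₂ → AdeleRing (𝓞 F) F) × (ι₂ → AdeleRing (𝓞 F) F))) h₂.v).1,
        Sum.elim (0 : ι₁ → AdeleRing (𝓞 F) F) ((g₂ : ((ι₂ → AdeleRing (𝓞 F) F) × (ι₂ → AdeleRing (𝓞 F) F)) ≃ₗ[AdeleRing (𝓞 F) F]
          ((ι₂ → AdeleRing (𝓞 F) F) × (ι₂ → AdeleRing (𝓞 F) F))) h₂.v).2) := by
    rw [spSum_apply_elim, Prod.mk.eta, Prod.mk_zero_zero, map_zero, Prod.fst_zero, Prod.snd_zero]
  apply Heisenberg.ext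
  · rw [Heisenberg.PseudoSymplectic.act_v, ofSymplectic_σ, inrH_v, inrH_v, Heisenberg.PseudoSymplectic.act_v, ofSymplectic_σ]
    exact hv
  · simp only [Heisenberg.PseudoSymplectic.act_t, inrH_t, inrH_v, ofSymplectic_f, polar_apply]
    rw [hv, adelicForm_fromBlocks_elim, adelicForm_fromBlocks_elim]
    simp only [map_zero, zero_add]

omit [DecidableEq ι₁] [DecidableEq ι₂] in
/-- **`y ↦ (T₁ ⊕ T₂) y` is onto when `y ↦ T_j y` are.** [folklore] -/
theorem mulVec_fromBlocks_surjective (hT₁ : Function.Surjective fun y : ι₁ → AdeleRing (𝓞 F) F => T₁ *ᵥ y)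
    (hT₂ : Function.Surjective fun y : ι₂ → AdeleRing (𝓞 F) F => T₂ *ᵥ y) :
    Function.Surjective fun y : ι₁ ⊕ ι₂ → AdeleRing (𝓞 F) F => Matrix.fromBlocks T₁ 0 0 T₂ *ᵥ y := by
  intro z
  obtain ⟨y₁, hy₁⟩ := hT₁ (z ∘ Sum.inl)
  obtain ⟨y₂, hy₂⟩ := hT₂ (z ∘ Sum.inr)
  refine ⟨Sum.elim y₁ y₂, ?_⟩
  show Matrix.fromBlocks T₁ 0 0 T₂ *ᵥ Sum.elim y₁ y₂ = z
  rw [Matrix.fromBlocks_mulVec, Sum.elim_comp_inl, Sum.elim_comp_inr, Matrix.zero_mulVec, Matrix.zero_mulVec, add_zero,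
    zero_add, show T₁ *ᵥ y₁ = z ∘ Sum.inl from hy₁, show T₂ *ᵥ y₂ = z ∘ Sum.inr from hy₂, Sum.elim_comp_inl_inr]

end Embeddings

/-! ### §2 The finite operator of a finite Heisenberg element -/

section FiniteOperator

variable {ι : Type} [Fintype ι] [DecidableEq ι] {T : Matrix ι ι (AdeleRing (𝓞 F) F)}

/-- A compactly supported smooth archimedean test function with `φ₀(0) = 1` (Mathlib's smooth Urysohn lemma on the
finite-dimensional space `(F ⊗ ℝ)^ι`). [folklore] -/
theorem exists_schwartzMap_apply_zero_eq_one (ι : Type) [Fintype ι] :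
    ∃ φ₀ : 𝓢((ι → mixedSpace F), ℂ), φ₀ 0 = 1 := by
  obtain ⟨f, -, hfc, hfd, -, hf0⟩ := exists_contDiff_tsupport_subset (E := ι → mixedSpace F)
    (n := (⊤ : ℕ∞)) (s := Set.univ) (x := (0 : ι → mixedSpace F)) Filter.univ_mem
  have hgc : HasCompactSupport fun a : ι → mixedSpace F => ((f a : ℝ) : ℂ) :=
    hfc.comp_left Complex.ofReal_zero
  have hgd : ContDiff ℝ ((⊤ : ℕ∞) : WithTop ℕ∞) fun a : ι → mixedSpace F => ((f a : ℝ) : ℂ) :=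
    Complex.ofRealCLM.contDiff.comp hfd
  exact ⟨hgc.toSchwartzMap hgd, by
    show ((f 0 : ℝ) : ℂ) = 1
    rw [hf0, Complex.ofReal_one]⟩

variable (F ι) in
/-- **The finite slice at an archimedean point `a`**: the linear map `𝒮(𝔸_F^ι) → 𝒮((𝔸_F^∞)^ι)`, `φ ⊗ f ↦ φ(a) • f`.
[folklore] -/
def finSliceLM (a : ι → mixedSpace F) : ↥(piSchwartzBruhat F ι) →ₗ[ℂ] FinSB F ι :=
  TensorProduct.lift
      (LinearMap.mk₂ ℂ (fun (Φinf : 𝓢((ι → mixedSpace F), ℂ)) (Φfin : FinSB F ι) => (Φinf a) • Φfin)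
        (fun _ _ _ => by simp only [add_apply, add_smul])
        (fun _ _ _ => by simp only [smul_apply, smul_eq_mul, mul_smul])
        (fun _ _ _ => smul_add _ _ _)
        (fun _ _ _ => smul_comm _ _ _)) ∘ₗ
    (piSchwartzBruhatEquiv F ι).symm.toLinearMap

omit [DecidableEq ι] in
/-- The finite slice of a pure tensor: `finSliceLM a (φ ⊗ f) = φ(a) • f`. [folklore] -/
theorem finSliceLM_tmul (a : ι → mixedSpace F) (Φinf : 𝓢((ι → mixedSpace F), ℂ)) (Φfin : FinSB F ι) :
    finSliceLM F ι a (piSchwartzBruhatEquiv F ι (Φinf ⊗ₜ Φfin)) = (Φinf a) • Φfin := by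
  simp only [finSliceLM, LinearMap.comp_apply, LinearEquiv.coe_toLinearMap, LinearEquiv.symm_apply_apply,
    TensorProduct.lift.tmul, LinearMap.mk₂_apply]

omit [DecidableEq ι] in
/-- **`1 ⊗ B` determines `B`.** [folklore] -/
theorem adelicTensorEnd_id_left_injective :
    Function.Injective fun B : FinSB F ι →ₗ[ℂ] FinSB F ι =>
      adelicTensorEnd (LinearMap.id : 𝓢((ι → mixedSpace F), ℂ) →ₗ[ℂ] 𝓢((ι → mixedSpace F), ℂ)) B := by
  intro B B' h
  obtain ⟨φ₀, hφ₀⟩ := exists_schwartzMap_apply_zero_eq_one (F := F) ι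
  apply LinearMap.ext
  intro f
  have h1 := congrArg (fun N : Module.End ℂ ↥(piSchwartzBruhat F ι) =>
    finSliceLM F ι 0 (N (piSchwartzBruhatEquiv F ι (φ₀ ⊗ₜ f)))) h
  simpa only [adelicTensorEnd_apply_tmul, LinearMap.id_apply, finSliceLM_tmul, hφ₀, one_smul] using h1

omit [DecidableEq ι] in
/-- `A ⊗ (c · B) = c · (A ⊗ B)`. [folklore] -/
theorem adelicTensorEnd_smul_right (A : 𝓢((ι → mixedSpace F), ℂ) →ₗ[ℂ] 𝓢((ι → mixedSpace F), ℂ)) (c : ℂ)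
    (B : FinSB F ι →ₗ[ℂ] FinSB F ι) : adelicTensorEnd A (c • B) = c • adelicTensorEnd A B := by
  simp only [adelicTensorEnd, TensorProduct.map_smul_right, LinearMap.smul_comp, LinearMap.comp_smul]

variable (T) in
/-- **The finite operator of a Heisenberg element** `h = ((x, y), t)`: `M_{(T y)_f} ∘ T_{x_f}` on `𝒮((𝔸_F^∞)^ι)`
(finite components of the translation by `x` and of the modulation by `T y`). [cite: Weil1964, Chap. I n° 4 p. 149] -/
def finOp (h : AdelicHeisenberg F ι T) : FinSB F ι →ₗ[ℂ] FinSB F ι :=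
  finModulateSB F ι (piFinite F ι (T *ᵥ h.v.2)) ∘ₗ finTranslateSB F ι (piFinite F ι h.v.1)

/-- unfolding `finOp`. [folklore] -/
theorem finOp_def (h : AdelicHeisenberg F ι T) :
    finOp T h = finModulateSB F ι (piFinite F ι (T *ᵥ h.v.2)) ∘ₗ finTranslateSB F ι (piFinite F ι h.v.1) := rfl

/-- **`ρ((x, y), t) = ψ_F(t) · (M_{T y} ∘ T_x)`** on `𝒮(𝔸_F^ι)` (Weil's `U(w)` twisted by the centre).
[cite: Weil1964, Chap. I n° 4 p. 149; MoeglinVignerasWaldspurger1987, Chap. 2 I.4 Exemple (1)] -/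
theorem adelicSchrodinger_eq_smul_modulateLM_comp_translateLM (h : AdelicHeisenberg F ι T) :
    adelicSchrodinger F ι T h =
      ((adeleAddChar F h.t : Circle) : ℂ) • (modulateLM F ι (T *ᵥ h.v.2) ∘ₗ translateLM F ι h.v.1) := by
  apply LinearMap.ext
  intro Φ
  apply Subtype.ext
  funext u
  simp only [adelicSchrodinger_apply, LinearMap.smul_apply, Submodule.coe_smul, Pi.smul_apply, smul_eq_mul,
    LinearMap.coe_comp, Function.comp_apply, coe_modulateLM_apply, coe_translateLM_apply, AddChar.map_add_eq_mul,
    Circle.coe_mul]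
  rw [dotProduct_comm, add_comm u h.v.1, mul_assoc]
  rfl

omit [Fintype ι] [DecidableEq ι] in
/-- A vector fixed by the finite idempotent is the finite vector of its finite components: `v = (0, v_f)`. [folklore] -/
theorem eq_piAdeleSplit_zero_piFinite {v : ι → AdeleRing (𝓞 F) F} (hv : finIdem F • v = v) :
    v = piAdeleSplit F ι (0, piFinite F ι v) := by
  funext i
  have hi : finIdem F * v i = v i := by
    have := congrFun hv i
    rwa [Pi.smul_apply, smul_eq_mul] at this
  refine Prod.ext ?_ rfl
  rw [piAdeleSplit_apply_fst, (finIdem_mul_eq_self_iff (v i)).1 hi]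
  exact (map_zero (InfiniteAdeleRing.ringEquiv_mixedSpace F).symm).symm

/-- **For a FINITE Heisenberg element, `ρ(h) = ψ_F(t) · (1 ⊗ finOp T h)`** in the tensor decomposition
`𝒮(𝔸_F^ι) = 𝓢((F ⊗ ℝ)^ι) ⊗ 𝒮((𝔸_F^∞)^ι)`. [cite: Weil1964, Chap. I n° 4 p. 149, Chap. III n° 37 p. 188] -/
theorem adelicSchrodinger_eq_smul_adelicTensorEnd_finOp {h : AdelicHeisenberg F ι T} (hh : h ∈ finHeisenberg T) :
    adelicSchrodinger F ι T h =
      ((adeleAddChar F h.t : Circle) : ℂ) •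
        adelicTensorEnd (LinearMap.id : 𝓢((ι → mixedSpace F), ℂ) →ₗ[ℂ] 𝓢((ι → mixedSpace F), ℂ)) (finOp T h) := by
  have hx : finIdem F • h.v.1 = h.v.1 := congrArg Prod.fst hh
  have hy : finIdem F • (T *ᵥ h.v.2) = T *ᵥ h.v.2 := by
    rw [← Matrix.mulVec_smul, show finIdem F • h.v.2 = h.v.2 from congrArg Prod.snd hh]
  rw [adelicSchrodinger_eq_smul_modulateLM_comp_translateLM]
  congr 1
  conv_lhs => rw [eq_piAdeleSplit_zero_piFinite hx, eq_piAdeleSplit_zero_piFinite hy]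
  rw [modulateLM_finVec_eq_adelicTensorEnd, translateLM_finVec_eq_adelicTensorEnd, ← adelicTensorEnd_comp,
    LinearMap.id_comp]
  rfl

/-- **Finite implementers, operator form on the finite factor.** If `1 ⊗ A` implements `g` on the finite Heisenberg
elements (`(1 ⊗ A) ρ(h) = ρ(g h) (1 ⊗ A)`), then `ψ_F(t) · A ∘ finOp T h = ψ_F(t') · finOp T (g h) ∘ A` on
`𝒮((𝔸_F^∞)^ι)`, `t' = (g h).t`. [cite: Weil1964, Chap. III n° 37–38 pp. 188–190] -/
theorem smul_comp_finOp_eq_of_implements {g : symplecticGroup (polar (adelicForm F ι T))} {A : FinSB F ι ≃ₗ[ℂ] FinSB F ι}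
    (hA : ∀ h ∈ finHeisenberg T, ∀ Φ : piSchwartzBruhat F ι,
      adelicTensorEnd LinearMap.id (A : FinSB F ι →ₗ[ℂ] FinSB F ι) (adelicSchrodinger F ι T h Φ) =
        adelicSchrodinger F ι T ((ofSymplectic (polar (adelicForm F ι T)) g).act h)
          (adelicTensorEnd LinearMap.id (A : FinSB F ι →ₗ[ℂ] FinSB F ι) Φ))
    {h : AdelicHeisenberg F ι T} (hh : h ∈ finHeisenberg T) :
    ((adeleAddChar F h.t : Circle) : ℂ) • ((A : FinSB F ι →ₗ[ℂ] FinSB F ι) ∘ₗ finOp T h) =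
      ((adeleAddChar F ((ofSymplectic (polar (adelicForm F ι T)) g).act h).t : Circle) : ℂ) •
        (finOp T ((ofSymplectic (polar (adelicForm F ι T)) g).act h) ∘ₗ (A : FinSB F ι →ₗ[ℂ] FinSB F ι)) := by
  have H : adelicTensorEnd LinearMap.id (A : FinSB F ι →ₗ[ℂ] FinSB F ι) ∘ₗ adelicSchrodinger F ι T h =
      adelicSchrodinger F ι T ((ofSymplectic (polar (adelicForm F ι T)) g).act h) ∘ₗ
        adelicTensorEnd LinearMap.id (A : FinSB F ι →ₗ[ℂ] FinSB F ι) :=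
    LinearMap.ext fun Φ => hA h hh Φ
  rw [adelicSchrodinger_eq_smul_adelicTensorEnd_finOp hh,
    adelicSchrodinger_eq_smul_adelicTensorEnd_finOp (act_mem_finHeisenberg _ hh), LinearMap.comp_smul,
    LinearMap.smul_comp, ← adelicTensorEnd_comp, ← adelicTensorEnd_comp, LinearMap.id_comp,
    ← adelicTensorEnd_smul_right, ← adelicTensorEnd_smul_right] at H
  exact adelicTensorEnd_id_left_injective H

end FiniteOperator

/-! ### §3 `1 ⊗ (A₁ ⊠ A₂)` implements `g₁ ⊕ g₂` on the finite Heisenberg elements -/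

section DirectSum

variable {ι₁ ι₂ : Type} [Fintype ι₁] [Fintype ι₂] [DecidableEq ι₁] [DecidableEq ι₂]
variable {T₁ : Matrix ι₁ ι₁ (AdeleRing (𝓞 F) F)} {T₂ : Matrix ι₂ ι₂ (AdeleRing (𝓞 F) F)}

omit [Fintype ι₁] [Fintype ι₂] [DecidableEq ι₁] [DecidableEq ι₂] in
/-- finite components of `a ⊔ 0`. [folklore] -/
theorem piFinite_sumElim_zero_right (a : ι₁ → AdeleRing (𝓞 F) F) :
    piFinite F (ι₁ ⊕ ι₂) (Sum.elim a (0 : ι₂ → AdeleRing (𝓞 F) F)) = Sum.elim (piFinite F ι₁ a) (0 : ι₂ → FiniteAdeleRing (𝓞 F) F) := by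
  funext i
  cases i <;> rfl

omit [Fintype ι₁] [Fintype ι₂] [DecidableEq ι₁] [DecidableEq ι₂] in
/-- finite components of `0 ⊔ b`. [folklore] -/
theorem piFinite_sumElim_zero_left (b : ι₂ → AdeleRing (𝓞 F) F) :
    piFinite F (ι₁ ⊕ ι₂) (Sum.elim (0 : ι₁ → AdeleRing (𝓞 F) F) b) = Sum.elim (0 : ι₁ → FiniteAdeleRing (𝓞 F) F) (piFinite F ι₂ b) := by
  funext i
  cases i <;> rfl

omit [DecidableEq ι₁] [DecidableEq ι₂] in
/-- `(c · B₁) ⊠ B₂ = c · (B₁ ⊠ B₂)`. [folklore] -/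
theorem finSumEnd_smul_left (c : ℂ) (B₁ : FinSB F ι₁ →ₗ[ℂ] FinSB F ι₁) (B₂ : FinSB F ι₂ →ₗ[ℂ] FinSB F ι₂) :
    finSumEnd (c • B₁) B₂ = c • finSumEnd B₁ B₂ := by
  simp only [finSumEnd, TensorProduct.map_smul_left, LinearMap.smul_comp, LinearMap.comp_smul]

omit [DecidableEq ι₁] [DecidableEq ι₂] in
/-- `B₁ ⊠ (c · B₂) = c · (B₁ ⊠ B₂)`. [folklore] -/
theorem finSumEnd_smul_right (c : ℂ) (B₁ : FinSB F ι₁ →ₗ[ℂ] FinSB F ι₁) (B₂ : FinSB F ι₂ →ₗ[ℂ] FinSB F ι₂) :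
    finSumEnd B₁ (c • B₂) = c • finSumEnd B₁ B₂ := by
  simp only [finSumEnd, TensorProduct.map_smul_right, LinearMap.smul_comp, LinearMap.comp_smul]

/-- **Block form along `W₁`**: `finOp (T₁ ⊕ T₂) (inlH h₁) = finOp T₁ h₁ ⊠ 1`. [cite: Weil1964, Chap. III n° 38 p. 190] -/
theorem finOp_inlH (h₁ : AdelicHeisenberg F ι₁ T₁) :
    finOp (Matrix.fromBlocks T₁ 0 0 T₂) (inlH T₁ T₂ h₁) = finSumEnd (finOp T₁ h₁) LinearMap.id := by
  rw [finOp_def, finOp_def, inlH_v]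
  simp only [Matrix.fromBlocks_mulVec, Sum.elim_comp_inl, Sum.elim_comp_inr, Matrix.zero_mulVec, Matrix.mulVec_zero,
    add_zero, piFinite_sumElim_zero_right, finModulateSB_sum_eq_finSumEnd, finTranslateSB_sum_eq_finSumEnd, resInl_elim,
    resInr_elim, finModulateSB_zero, finTranslateSB_zero]
  rw [← finSumEnd_comp, LinearMap.id_comp]

/-- **Block form along `W₂`**: `finOp (T₁ ⊕ T₂) (inrH h₂) = 1 ⊠ finOp T₂ h₂`. [cite: Weil1964, Chap. III n° 38 p. 190] -/
theorem finOp_inrH (h₂ : AdelicHeisenberg F ι₂ T₂) :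
    finOp (Matrix.fromBlocks T₁ 0 0 T₂) (inrH T₁ T₂ h₂) = finSumEnd LinearMap.id (finOp T₂ h₂) := by
  rw [finOp_def, finOp_def, inrH_v]
  simp only [Matrix.fromBlocks_mulVec, Sum.elim_comp_inl, Sum.elim_comp_inr, Matrix.zero_mulVec, Matrix.mulVec_zero,
    zero_add, piFinite_sumElim_zero_left, finModulateSB_sum_eq_finSumEnd, finTranslateSB_sum_eq_finSumEnd, resInl_elim,
    resInr_elim, finModulateSB_zero, finTranslateSB_zero]
  rw [← finSumEnd_comp, LinearMap.id_comp]

omit [DecidableEq ι₁] [DecidableEq ι₂] in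
/-- Transport of a twisted commutation relation `c · A₁ B = c' · B' A₁` on `𝒮((𝔸_F^∞)^{ι₁})` to
`1 ⊗ (A₁ ⊠ A₂)` versus `c · 1 ⊗ (B ⊠ 1)`, `c' · 1 ⊗ (B' ⊠ 1)` on `𝒮(𝔸_F^{ι₁ ⊕ ι₂})`. [folklore] -/
theorem adelicTensorEnd_finSumEnd_comp_inl {A₁ B B' : FinSB F ι₁ →ₗ[ℂ] FinSB F ι₁} {A₂ : FinSB F ι₂ →ₗ[ℂ] FinSB F ι₂}
    {c c' : ℂ} (hc : c • (A₁ ∘ₗ B) = c' • (B' ∘ₗ A₁)) :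
    adelicTensorEnd (LinearMap.id : 𝓢((ι₁ ⊕ ι₂ → mixedSpace F), ℂ) →ₗ[ℂ] 𝓢((ι₁ ⊕ ι₂ → mixedSpace F), ℂ)) (finSumEnd A₁ A₂) ∘ₗ
        (c • adelicTensorEnd (LinearMap.id : 𝓢((ι₁ ⊕ ι₂ → mixedSpace F), ℂ) →ₗ[ℂ] 𝓢((ι₁ ⊕ ι₂ → mixedSpace F), ℂ))
          (finSumEnd B LinearMap.id)) =
      (c' • adelicTensorEnd (LinearMap.id : 𝓢((ι₁ ⊕ ι₂ → mixedSpace F), ℂ) →ₗ[ℂ] 𝓢((ι₁ ⊕ ι₂ → mixedSpace F), ℂ))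
          (finSumEnd B' LinearMap.id)) ∘ₗ
        adelicTensorEnd (LinearMap.id : 𝓢((ι₁ ⊕ ι₂ → mixedSpace F), ℂ) →ₗ[ℂ] 𝓢((ι₁ ⊕ ι₂ → mixedSpace F), ℂ)) (finSumEnd A₁ A₂) := by
  rw [LinearMap.comp_smul, LinearMap.smul_comp, ← adelicTensorEnd_comp, ← adelicTensorEnd_comp, LinearMap.id_comp,
    ← finSumEnd_comp, ← finSumEnd_comp, LinearMap.comp_id, LinearMap.id_comp, ← adelicTensorEnd_smul_right,
    ← adelicTensorEnd_smul_right, ← finSumEnd_smul_left, ← finSumEnd_smul_left, hc]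

omit [DecidableEq ι₁] [DecidableEq ι₂] in
/-- The same transport along the second summand. [folklore] -/
theorem adelicTensorEnd_finSumEnd_comp_inr {A₁ : FinSB F ι₁ →ₗ[ℂ] FinSB F ι₁} {A₂ B B' : FinSB F ι₂ →ₗ[ℂ] FinSB F ι₂}
    {c c' : ℂ} (hc : c • (A₂ ∘ₗ B) = c' • (B' ∘ₗ A₂)) :
    adelicTensorEnd (LinearMap.id : 𝓢((ι₁ ⊕ ι₂ → mixedSpace F), ℂ) →ₗ[ℂ] 𝓢((ι₁ ⊕ ι₂ → mixedSpace F), ℂ)) (finSumEnd A₁ A₂) ∘ₗ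
        (c • adelicTensorEnd (LinearMap.id : 𝓢((ι₁ ⊕ ι₂ → mixedSpace F), ℂ) →ₗ[ℂ] 𝓢((ι₁ ⊕ ι₂ → mixedSpace F), ℂ))
          (finSumEnd LinearMap.id B)) =
      (c' • adelicTensorEnd (LinearMap.id : 𝓢((ι₁ ⊕ ι₂ → mixedSpace F), ℂ) →ₗ[ℂ] 𝓢((ι₁ ⊕ ι₂ → mixedSpace F), ℂ))
          (finSumEnd LinearMap.id B')) ∘ₗ
        adelicTensorEnd (LinearMap.id : 𝓢((ι₁ ⊕ ι₂ → mixedSpace F), ℂ) →ₗ[ℂ] 𝓢((ι₁ ⊕ ι₂ → mixedSpace F), ℂ)) (finSumEnd A₁ A₂) := by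
  rw [LinearMap.comp_smul, LinearMap.smul_comp, ← adelicTensorEnd_comp, ← adelicTensorEnd_comp, LinearMap.id_comp,
    ← finSumEnd_comp, ← finSumEnd_comp, LinearMap.comp_id, LinearMap.id_comp, ← adelicTensorEnd_smul_right,
    ← adelicTensorEnd_smul_right, ← finSumEnd_smul_right, ← finSumEnd_smul_right, hc]

/-- **Commutation past the first summand**: if `1 ⊗ A₁` implements `g₁` on the finite Heisenberg elements of `W₁`,
then `1 ⊗ (A₁ ⊠ A₂)` intertwines `ρ(inlH h₁)` with `ρ(inlH (g₁ · h₁))` for finite `h₁`.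
[cite: Weil1964, Chap. III n° 37–38 pp. 188–190] -/
theorem finSumEnd_comp_adelicSchrodinger_inlH {g₁ : symplecticGroup (polar (adelicForm F ι₁ T₁))}
    {A₁ : FinSB F ι₁ ≃ₗ[ℂ] FinSB F ι₁}
    (hA₁ : ∀ h ∈ finHeisenberg T₁, ∀ Φ : piSchwartzBruhat F ι₁,
      adelicTensorEnd LinearMap.id (A₁ : FinSB F ι₁ →ₗ[ℂ] FinSB F ι₁) (adelicSchrodinger F ι₁ T₁ h Φ) =
        adelicSchrodinger F ι₁ T₁ ((ofSymplectic (polar (adelicForm F ι₁ T₁)) g₁).act h)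
          (adelicTensorEnd LinearMap.id (A₁ : FinSB F ι₁ →ₗ[ℂ] FinSB F ι₁) Φ))
    (A₂ : FinSB F ι₂ →ₗ[ℂ] FinSB F ι₂) {h₁ : AdelicHeisenberg F ι₁ T₁} (hh₁ : h₁ ∈ finHeisenberg T₁) :
    adelicTensorEnd (LinearMap.id : 𝓢((ι₁ ⊕ ι₂ → mixedSpace F), ℂ) →ₗ[ℂ] 𝓢((ι₁ ⊕ ι₂ → mixedSpace F), ℂ))
          (finSumEnd (A₁ : FinSB F ι₁ →ₗ[ℂ] FinSB F ι₁) A₂) ∘ₗ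
        adelicSchrodinger F (ι₁ ⊕ ι₂) (Matrix.fromBlocks T₁ 0 0 T₂) (inlH T₁ T₂ h₁) =
      adelicSchrodinger F (ι₁ ⊕ ι₂) (Matrix.fromBlocks T₁ 0 0 T₂)
          (inlH T₁ T₂ ((ofSymplectic (polar (adelicForm F ι₁ T₁)) g₁).act h₁)) ∘ₗ
        adelicTensorEnd (LinearMap.id : 𝓢((ι₁ ⊕ ι₂ → mixedSpace F), ℂ) →ₗ[ℂ] 𝓢((ι₁ ⊕ ι₂ → mixedSpace F), ℂ))
          (finSumEnd (A₁ : FinSB F ι₁ →ₗ[ℂ] FinSB F ι₁) A₂) := by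
  rw [adelicSchrodinger_eq_smul_adelicTensorEnd_finOp (inlH_mem_finHeisenberg hh₁),
    adelicSchrodinger_eq_smul_adelicTensorEnd_finOp (inlH_mem_finHeisenberg (act_mem_finHeisenberg _ hh₁)), finOp_inlH,
    finOp_inlH, inlH_t, inlH_t]
  exact adelicTensorEnd_finSumEnd_comp_inl (smul_comp_finOp_eq_of_implements hA₁ hh₁)

/-- **Commutation past the second summand.** [cite: Weil1964, Chap. III n° 37–38 pp. 188–190] -/
theorem finSumEnd_comp_adelicSchrodinger_inrH (A₁ : FinSB F ι₁ →ₗ[ℂ] FinSB F ι₁)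
    {g₂ : symplecticGroup (polar (adelicForm F ι₂ T₂))} {A₂ : FinSB F ι₂ ≃ₗ[ℂ] FinSB F ι₂}
    (hA₂ : ∀ h ∈ finHeisenberg T₂, ∀ Φ : piSchwartzBruhat F ι₂,
      adelicTensorEnd LinearMap.id (A₂ : FinSB F ι₂ →ₗ[ℂ] FinSB F ι₂) (adelicSchrodinger F ι₂ T₂ h Φ) =
        adelicSchrodinger F ι₂ T₂ ((ofSymplectic (polar (adelicForm F ι₂ T₂)) g₂).act h)
          (adelicTensorEnd LinearMap.id (A₂ : FinSB F ι₂ →ₗ[ℂ] FinSB F ι₂) Φ))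
    {h₂ : AdelicHeisenberg F ι₂ T₂} (hh₂ : h₂ ∈ finHeisenberg T₂) :
    adelicTensorEnd (LinearMap.id : 𝓢((ι₁ ⊕ ι₂ → mixedSpace F), ℂ) →ₗ[ℂ] 𝓢((ι₁ ⊕ ι₂ → mixedSpace F), ℂ))
          (finSumEnd A₁ (A₂ : FinSB F ι₂ →ₗ[ℂ] FinSB F ι₂)) ∘ₗ
        adelicSchrodinger F (ι₁ ⊕ ι₂) (Matrix.fromBlocks T₁ 0 0 T₂) (inrH T₁ T₂ h₂) =
      adelicSchrodinger F (ι₁ ⊕ ι₂) (Matrix.fromBlocks T₁ 0 0 T₂)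
          (inrH T₁ T₂ ((ofSymplectic (polar (adelicForm F ι₂ T₂)) g₂).act h₂)) ∘ₗ
        adelicTensorEnd (LinearMap.id : 𝓢((ι₁ ⊕ ι₂ → mixedSpace F), ℂ) →ₗ[ℂ] 𝓢((ι₁ ⊕ ι₂ → mixedSpace F), ℂ))
          (finSumEnd A₁ (A₂ : FinSB F ι₂ →ₗ[ℂ] FinSB F ι₂)) := by
  rw [adelicSchrodinger_eq_smul_adelicTensorEnd_finOp (inrH_mem_finHeisenberg hh₂),
    adelicSchrodinger_eq_smul_adelicTensorEnd_finOp (inrH_mem_finHeisenberg (act_mem_finHeisenberg _ hh₂)), finOp_inrH,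
    finOp_inrH, inrH_t, inrH_t]
  exact adelicTensorEnd_finSumEnd_comp_inr (smul_comp_finOp_eq_of_implements hA₂ hh₂)

/-- **`1 ⊗ (A₁ ⊠ A₂)` implements `g₁ ⊕ g₂` on the finite Heisenberg elements of `W₁ ⊕ W₂`** when `1 ⊗ A_j`
implements `g_j` on the finite Heisenberg elements of `W_j` — operator form. This is the finite-place content of
`𝐫_A(s₁ ⊕ s₂) = 𝐫_A(s₁) ⊗ 𝐫_A(s₂)` for the orthogonal direct sum. [cite: Weil1964, Chap. III n° 37–38 pp. 188–190;
Kudla1984, §1] -/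
theorem finSumEnd_comp_adelicSchrodinger_of_implements
    {g₁ : symplecticGroup (polar (adelicForm F ι₁ T₁))} {g₂ : symplecticGroup (polar (adelicForm F ι₂ T₂))}
    {A₁ : FinSB F ι₁ ≃ₗ[ℂ] FinSB F ι₁} {A₂ : FinSB F ι₂ ≃ₗ[ℂ] FinSB F ι₂}
    (hA₁ : ∀ h ∈ finHeisenberg T₁, ∀ Φ : piSchwartzBruhat F ι₁,
      adelicTensorEnd LinearMap.id (A₁ : FinSB F ι₁ →ₗ[ℂ] FinSB F ι₁) (adelicSchrodinger F ι₁ T₁ h Φ) =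
        adelicSchrodinger F ι₁ T₁ ((ofSymplectic (polar (adelicForm F ι₁ T₁)) g₁).act h)
          (adelicTensorEnd LinearMap.id (A₁ : FinSB F ι₁ →ₗ[ℂ] FinSB F ι₁) Φ))
    (hA₂ : ∀ h ∈ finHeisenberg T₂, ∀ Φ : piSchwartzBruhat F ι₂,
      adelicTensorEnd LinearMap.id (A₂ : FinSB F ι₂ →ₗ[ℂ] FinSB F ι₂) (adelicSchrodinger F ι₂ T₂ h Φ) =
        adelicSchrodinger F ι₂ T₂ ((ofSymplectic (polar (adelicForm F ι₂ T₂)) g₂).act h)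
          (adelicTensorEnd LinearMap.id (A₂ : FinSB F ι₂ →ₗ[ℂ] FinSB F ι₂) Φ))
    {h : AdelicHeisenberg F (ι₁ ⊕ ι₂) (Matrix.fromBlocks T₁ 0 0 T₂)} (hh : h ∈ finHeisenberg (Matrix.fromBlocks T₁ 0 0 T₂)) :
    adelicTensorEnd (LinearMap.id : 𝓢((ι₁ ⊕ ι₂ → mixedSpace F), ℂ) →ₗ[ℂ] 𝓢((ι₁ ⊕ ι₂ → mixedSpace F), ℂ))
          (finSumEnd (A₁ : FinSB F ι₁ →ₗ[ℂ] FinSB F ι₁) (A₂ : FinSB F ι₂ →ₗ[ℂ] FinSB F ι₂)) ∘ₗ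
        adelicSchrodinger F (ι₁ ⊕ ι₂) (Matrix.fromBlocks T₁ 0 0 T₂) h =
      adelicSchrodinger F (ι₁ ⊕ ι₂) (Matrix.fromBlocks T₁ 0 0 T₂)
          ((ofSymplectic (polar (adelicForm F (ι₁ ⊕ ι₂) (Matrix.fromBlocks T₁ 0 0 T₂))) (UnitaryGroup.spSum T₁ T₂ (g₁, g₂))).act h) ∘ₗ
        adelicTensorEnd (LinearMap.id : 𝓢((ι₁ ⊕ ι₂ → mixedSpace F), ℂ) →ₗ[ℂ] 𝓢((ι₁ ⊕ ι₂ → mixedSpace F), ℂ))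
          (finSumEnd (A₁ : FinSB F ι₁ →ₗ[ℂ] FinSB F ι₁) (A₂ : FinSB F ι₂ →ₗ[ℂ] FinSB F ι₂)) := by
  obtain ⟨h₁, hh₁, h₂, hh₂, rfl⟩ := exists_eq_inlH_mul_inrH hh
  rw [map_mul, Heisenberg.PseudoSymplectic.act_mul, map_mul, act_spSum_inlH, act_spSum_inrH, Module.End.mul_eq_comp,
    Module.End.mul_eq_comp, ← LinearMap.comp_assoc, finSumEnd_comp_adelicSchrodinger_inlH hA₁ _ hh₁, LinearMap.comp_assoc,
    finSumEnd_comp_adelicSchrodinger_inrH _ hA₂ hh₂, ← LinearMap.comp_assoc]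

/-- **`finSumAut_implements_spSum`** — the hypothesis shape of
`AdelicMetaplecticTensorStripping.exists_continuousLinearEquiv_of_mem_adelicMpCont` for the automorphism
`A₁ ⊠ A₂ = finSumAut A₁ A₂` of `𝒮((𝔸_F^∞)^{ι₁ ⊕ ι₂})` and the element `g₁ ⊕ g₂ = spSum T₁ T₂ (g₁, g₂)` of
`Sp(W₁ ⊕ W₂)(𝔸_F)`: if `1 ⊗ A_j` implements `g_j` on the finite Heisenberg elements of `W_j` (`j = 1, 2`), then
`1 ⊗ (A₁ ⊠ A₂)` implements `g₁ ⊕ g₂` on the finite Heisenberg elements of `W₁ ⊕ W₂`.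
[cite: Weil1964, Chap. III n° 37–38 pp. 188–190; Kudla1984, §1] -/
theorem finSumAut_implements_spSum
    {g₁ : symplecticGroup (polar (adelicForm F ι₁ T₁))} {g₂ : symplecticGroup (polar (adelicForm F ι₂ T₂))}
    {A₁ : FinSB F ι₁ ≃ₗ[ℂ] FinSB F ι₁} {A₂ : FinSB F ι₂ ≃ₗ[ℂ] FinSB F ι₂}
    (hA₁ : ∀ h ∈ finHeisenberg T₁, ∀ Φ : piSchwartzBruhat F ι₁,
      adelicTensorEnd LinearMap.id (A₁ : FinSB F ι₁ →ₗ[ℂ] FinSB F ι₁) (adelicSchrodinger F ι₁ T₁ h Φ) =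
        adelicSchrodinger F ι₁ T₁ ((ofSymplectic (polar (adelicForm F ι₁ T₁)) g₁).act h)
          (adelicTensorEnd LinearMap.id (A₁ : FinSB F ι₁ →ₗ[ℂ] FinSB F ι₁) Φ))
    (hA₂ : ∀ h ∈ finHeisenberg T₂, ∀ Φ : piSchwartzBruhat F ι₂,
      adelicTensorEnd LinearMap.id (A₂ : FinSB F ι₂ →ₗ[ℂ] FinSB F ι₂) (adelicSchrodinger F ι₂ T₂ h Φ) =
        adelicSchrodinger F ι₂ T₂ ((ofSymplectic (polar (adelicForm F ι₂ T₂)) g₂).act h)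
          (adelicTensorEnd LinearMap.id (A₂ : FinSB F ι₂ →ₗ[ℂ] FinSB F ι₂) Φ)) :
    ∀ h ∈ finHeisenberg (Matrix.fromBlocks T₁ 0 0 T₂), ∀ Φ : piSchwartzBruhat F (ι₁ ⊕ ι₂),
      adelicTensorEnd LinearMap.id (finSumAut A₁ A₂ : FinSB F (ι₁ ⊕ ι₂) →ₗ[ℂ] FinSB F (ι₁ ⊕ ι₂))
          (adelicSchrodinger F (ι₁ ⊕ ι₂) (Matrix.fromBlocks T₁ 0 0 T₂) h Φ) =
        adelicSchrodinger F (ι₁ ⊕ ι₂) (Matrix.fromBlocks T₁ 0 0 T₂)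
          ((ofSymplectic (polar (adelicForm F (ι₁ ⊕ ι₂) (Matrix.fromBlocks T₁ 0 0 T₂))) (UnitaryGroup.spSum T₁ T₂ (g₁, g₂))).act h)
          (adelicTensorEnd LinearMap.id (finSumAut A₁ A₂ : FinSB F (ι₁ ⊕ ι₂) →ₗ[ℂ] FinSB F (ι₁ ⊕ ι₂)) Φ) := by
  intro h hh Φ
  rw [coe_finSumAut]
  exact LinearMap.congr_fun (finSumEnd_comp_adelicSchrodinger_of_implements hA₁ hA₂ hh) Φ

/-- **The same statement for an implementing pair `p = (g₁ ⊕ g₂, M) ∈ Mp_ψ(W₁ ⊕ W₂)`** — literally the hypothesis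
`hMf` of `exists_continuousLinearEquiv_of_mem_adelicMpCont` / `exists_continuousLinearEquiv_map_tmul_of_mem_adelicMpCont`
at `Mf := finSumAut A₁ A₂`. [cite: Weil1964, Chap. III n° 37–38 pp. 188–190] -/
theorem finSumAut_implements_of_fst_eq_spSum
    {g₁ : symplecticGroup (polar (adelicForm F ι₁ T₁))} {g₂ : symplecticGroup (polar (adelicForm F ι₂ T₂))}
    {A₁ : FinSB F ι₁ ≃ₗ[ℂ] FinSB F ι₁} {A₂ : FinSB F ι₂ ≃ₗ[ℂ] FinSB F ι₂}
    (hA₁ : ∀ h ∈ finHeisenberg T₁, ∀ Φ : piSchwartzBruhat F ι₁,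
      adelicTensorEnd LinearMap.id (A₁ : FinSB F ι₁ →ₗ[ℂ] FinSB F ι₁) (adelicSchrodinger F ι₁ T₁ h Φ) =
        adelicSchrodinger F ι₁ T₁ ((ofSymplectic (polar (adelicForm F ι₁ T₁)) g₁).act h)
          (adelicTensorEnd LinearMap.id (A₁ : FinSB F ι₁ →ₗ[ℂ] FinSB F ι₁) Φ))
    (hA₂ : ∀ h ∈ finHeisenberg T₂, ∀ Φ : piSchwartzBruhat F ι₂,
      adelicTensorEnd LinearMap.id (A₂ : FinSB F ι₂ →ₗ[ℂ] FinSB F ι₂) (adelicSchrodinger F ι₂ T₂ h Φ) =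
        adelicSchrodinger F ι₂ T₂ ((ofSymplectic (polar (adelicForm F ι₂ T₂)) g₂).act h)
          (adelicTensorEnd LinearMap.id (A₂ : FinSB F ι₂ →ₗ[ℂ] FinSB F ι₂) Φ))
    (p : adelicMp F (ι₁ ⊕ ι₂) (Matrix.fromBlocks T₁ 0 0 T₂))
    (hp : (p : symplecticGroup (polar (adelicForm F (ι₁ ⊕ ι₂) (Matrix.fromBlocks T₁ 0 0 T₂))) ×
        (piSchwartzBruhat F (ι₁ ⊕ ι₂) ≃ₗ[ℂ] piSchwartzBruhat F (ι₁ ⊕ ι₂))).1 = UnitaryGroup.spSum T₁ T₂ (g₁, g₂)) :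
    ∀ h ∈ finHeisenberg (Matrix.fromBlocks T₁ 0 0 T₂), ∀ Φ : piSchwartzBruhat F (ι₁ ⊕ ι₂),
      adelicTensorEnd LinearMap.id (finSumAut A₁ A₂ : FinSB F (ι₁ ⊕ ι₂) →ₗ[ℂ] FinSB F (ι₁ ⊕ ι₂))
          (adelicSchrodinger F (ι₁ ⊕ ι₂) (Matrix.fromBlocks T₁ 0 0 T₂) h Φ) =
        adelicSchrodinger F (ι₁ ⊕ ι₂) (Matrix.fromBlocks T₁ 0 0 T₂)
          ((ofSymplectic (polar (adelicForm F (ι₁ ⊕ ι₂) (Matrix.fromBlocks T₁ 0 0 T₂)))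
            (p : symplecticGroup (polar (adelicForm F (ι₁ ⊕ ι₂) (Matrix.fromBlocks T₁ 0 0 T₂))) ×
              (piSchwartzBruhat F (ι₁ ⊕ ι₂) ≃ₗ[ℂ] piSchwartzBruhat F (ι₁ ⊕ ι₂))).1).act h)
          (adelicTensorEnd LinearMap.id (finSumAut A₁ A₂ : FinSB F (ι₁ ⊕ ι₂) →ₗ[ℂ] FinSB F (ι₁ ⊕ ι₂)) Φ) := by
  rw [hp]
  exact finSumAut_implements_spSum hA₁ hA₂

end DirectSum

end Literature.NumberTheory.Weil1964

end
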